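import Literature.Analysis.FluidPDE.DriftHeatKernelWindow
import HarnessLib

/-!
# Finite nets of balls and the Harnack chain of infima along a segment

Analysis/FluidPDE proofs file (theorems only), third support file on the discharge path of the
named fact `Literature.Analysis.FluidPDE.Lieberman1996_weak_harnack` (Lieberman 1996, Ch. VI,
Corollary 6.24, weak Harnack inequality with flexible cylinders for `uₜ + a·∇u − Δu = 0` with
bounded measurable drift). Purely geometric ingredients of the assembly
(`ParabolicLocalEstimatesProofs`):

* `exists_finset_net_unitBall`, `exists_near_center_of_mem_ball` — a finite `ε`-net of the unit
  ball with centres of norm `< 1 + ε`, and its rescaling to any ball `B(y, r)` (the number of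
  small balls covering `B(y₂, θ₂R)` is then independent of `R`);
* `closedBall_combo_subset` — closed balls around the points of a segment stay inside a convex
  set containing the closed balls around its endpoints;
* `chain_lower_bound` — the abstract **Harnack chain**: if a lower bound of `u(τ₁, ·)` on
  `B̄(z, ρ/8)` always propagates, multiplied by `Λ`, to `B̄(z, 3ρ/8)` at any time `τ₂` with
  `κ₁ρ² ≤ τ₂ − τ₁ ≤ κsρ²`, then along `N` equal steps on the segment from `z₀` to `x`
  (`dist x z₀ ≤ Nρ/4`, total time in `[Nκ₁ρ², Nκsρ²]`) a lower bound `μ₀` at `(z₀, T₀)` yields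
  `Λᴺ μ₀ ≤ u(T₁, x)` (Lieberman 1996, the chaining arguments of Theorems 2.7 and 6.25).

## References

* G. M. Lieberman, *Second Order Parabolic Differential Equations*, World Scientific (1996),
  Ch. II Thm 2.7, Ch. VI §7 Thm 6.25 (chaining). [Lieberman1996]
-/

noncomputable section

open MeasureTheory Set Function Filter Metric Real InnerProductSpace Topology
open scoped Laplacian

namespace Literature.Analysis.FluidPDE

variable {E : Type*} [NormedAddCommGroup E] [InnerProductSpace ℝ E] [FiniteDimensional ℝ E]
  [MeasurableSpace E] [BorelSpace E]

/-! ### A finite net of the unit ball and its rescalings -/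

section Cover

omit [MeasurableSpace E] [BorelSpace E] in
/-- **Finite `ε`-net of the unit ball** with centres of norm `< 1 + ε` (total boundedness of
the closed unit ball of a finite-dimensional space). [folklore] -/
theorem exists_finset_net_unitBall {ε : ℝ} (hε : 0 < ε) :
    ∃ P : Finset E, (∀ p ∈ P, ‖p‖ < 1 + ε) ∧
      ∀ w ∈ ball (0 : E) 1, ∃ p ∈ P, dist w p < ε := by
  classical
  have htb : TotallyBounded (ball (0 : E) 1) :=
    (isCompact_closedBall (0 : E) 1).totallyBounded.subset ball_subset_closedBall
  obtain ⟨t, htf, hcover⟩ := Metric.totallyBounded_iff.1 htb ε hε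
  refine ⟨htf.toFinset.filter (fun p => ‖p‖ < 1 + ε), fun p hp => (Finset.mem_filter.1 hp).2,
    fun w hw => ?_⟩
  obtain ⟨p, hp, hwp⟩ : ∃ p ∈ t, w ∈ ball p ε := by
    simpa only [mem_iUnion, exists_prop] using hcover hw
  have h1 : ‖w‖ < 1 := by simpa using hw
  have h2 : dist w p < ε := mem_ball.1 hwp
  refine ⟨p, Finset.mem_filter.2 ⟨htf.mem_toFinset.2 hp, ?_⟩, h2⟩
  calc ‖p‖ = dist p 0 := (dist_zero_right p).symm
    _ ≤ dist p w + dist w 0 := dist_triangle _ _ _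
    _ < ε + 1 := by
        rw [dist_comm, dist_zero_right]
        exact add_lt_add h2 h1
    _ = 1 + ε := add_comm _ _

omit [FiniteDimensional ℝ E] [MeasurableSpace E] [BorelSpace E] in
/-- Rescaling a net of the unit ball: every point of `B(y, r)` is within `rε` of a centre
`y + r p`. [folklore] -/
theorem exists_near_center_of_mem_ball {P : Finset E} {ε : ℝ}
    (hP : ∀ w ∈ ball (0 : E) 1, ∃ p ∈ P, dist w p < ε) {y : E} {r : ℝ} (hr : 0 < r) {z : E}
    (hz : z ∈ ball y r) : ∃ p ∈ P, dist z (y + r • p) < r * ε := by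
  set w : E := r⁻¹ • (z - y) with hw_def
  have hw : w ∈ ball (0 : E) 1 := by
    rw [mem_ball, dist_zero_right, hw_def, norm_smul, norm_inv, Real.norm_of_nonneg hr.le,
      ← dist_eq_norm, inv_mul_lt_iff₀ hr, mul_one]
    exact mem_ball.1 hz
  obtain ⟨p, hp, hwp⟩ := hP w hw
  refine ⟨p, hp, ?_⟩
  have e : z - (y + r • p) = r • (w - p) := by
    rw [hw_def, smul_sub, smul_smul, mul_inv_cancel₀ hr.ne', one_smul]
    abel
  rw [dist_eq_norm, e, norm_smul, Real.norm_of_nonneg hr.le, ← dist_eq_norm]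
  exact mul_lt_mul_of_pos_left hwp hr

end Cover

/-! ### The chain of infima along a segment -/

section Chain

omit [FiniteDimensional ℝ E] [MeasurableSpace E] [BorelSpace E] in
/-- A closed ball around a point of the segment `[z₀, x]` lies in a convex set containing the
closed balls of the same radius around `z₀` and `x`. [folklore] -/
theorem closedBall_combo_subset {V : Set E} (hV : Convex ℝ V) {z₀ x : E}
    {ρ : ℝ} (hz₀ : closedBall z₀ ρ ⊆ V) (hx : closedBall x ρ ⊆ V) {l : ℝ} (hl0 : 0 ≤ l)
    (hl1 : l ≤ 1) : closedBall (z₀ + l • (x - z₀)) ρ ⊆ V := by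
  intro w hw
  set e : E := w - (z₀ + l • (x - z₀)) with he
  have hen : ‖e‖ ≤ ρ := by rw [he, ← dist_eq_norm]; exact mem_closedBall.1 hw
  have h1 : z₀ + e ∈ V := hz₀ (by rw [mem_closedBall, dist_eq_norm]; simpa using hen)
  have h2 : x + e ∈ V := hx (by rw [mem_closedBall, dist_eq_norm]; simpa using hen)
  have hcombo := hV h1 h2 (by linarith : 0 ≤ 1 - l) hl0 (by ring)
  have hweq : (1 - l) • (z₀ + e) + l • (x + e) = w := by
    rw [he]
    module
  rwa [hweq] at hcombo

omit [FiniteDimensional ℝ E] [MeasurableSpace E] [BorelSpace E] in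
/-- **Chain of infima along a segment.** Suppose a lower bound `μ ≥ 0` of `u(τ₁, ·)` on
`B̄(z, ρ/8)` always propagates to the lower bound `Λ μ` of `u(τ₂, ·)` on `B̄(z, 3ρ/8)` whenever
`B̄(z, ρ) ⊆ V` (`V` convex), `τ₁, τ₂ ∈ I` (an interval) and `κ₁ρ² ≤ τ₂ − τ₁ ≤ κsρ²` (one
"step", `Λ ≥ 0`). Then along `N ≥ 1` equal steps from `(z₀, T₀)` to `(x, T₁)` with
`B̄(z₀, ρ), B̄(x, ρ) ⊆ V`, `dist x z₀ ≤ Nρ/4`, `Nκ₁ρ² ≤ T₁ − T₀ ≤ Nκsρ²`, a lower bound `μ₀ ≥ 0` of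
`u(T₀, ·)` on `B̄(z₀, ρ/8)` yields `Λᴺ μ₀ ≤ u(T₁, x)` (Moser's Harnack chain; Lieberman 1996,
proof of Theorem 6.25 / chaining argument of Theorem 2.7). [cite: Lieberman1996, Ch. VI Thm 6.25 (chaining argument)] -/
theorem chain_lower_bound {u : ℝ → E → ℝ} {V : Set E} (hV : Convex ℝ V) {ρ κ₁ κs Λ : ℝ}
    (hρ : 0 < ρ) (hκ₁ : 0 ≤ κ₁) (hΛ : 0 ≤ Λ) {I : Set ℝ} (hI : I.OrdConnected)
    (step : ∀ (z : E) (τ₁ τ₂ : ℝ), closedBall z ρ ⊆ V → τ₁ ∈ I → τ₂ ∈ I →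
      κ₁ * ρ ^ 2 ≤ τ₂ - τ₁ → τ₂ - τ₁ ≤ κs * ρ ^ 2 → ∀ μ : ℝ, 0 ≤ μ →
      (∀ y ∈ closedBall z (ρ / 8), μ ≤ u τ₁ y) →
        ∀ y ∈ closedBall z (3 / 8 * ρ), Λ * μ ≤ u τ₂ y)
    {N : ℕ} (hN : 0 < N) {z₀ x : E} (hz₀ : closedBall z₀ ρ ⊆ V) (hx : closedBall x ρ ⊆ V)
    (hdist : dist x z₀ ≤ N * (ρ / 4)) {T₀ T₁ : ℝ} (hT₀ : T₀ ∈ I) (hT₁ : T₁ ∈ I)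
    (hlow : N * (κ₁ * ρ ^ 2) ≤ T₁ - T₀) (hup : T₁ - T₀ ≤ N * (κs * ρ ^ 2))
    {μ₀ : ℝ} (hμ₀ : 0 ≤ μ₀) (h0 : ∀ y ∈ closedBall z₀ (ρ / 8), μ₀ ≤ u T₀ y) :
    Λ ^ N * μ₀ ≤ u T₁ x := by
  have hNr : (0 : ℝ) < N := Nat.cast_pos.2 hN
  set dT : ℝ := (T₁ - T₀) / N with hdT
  set z : ℕ → E := fun i => z₀ + ((i : ℝ) / N) • (x - z₀) with hz_def
  set T : ℕ → ℝ := fun i => T₀ + i * dT with hT_def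
  have hT01 : T₀ ≤ T₁ := by nlinarith [mul_nonneg hκ₁ (sq_nonneg ρ)]
  have hdT0 : 0 ≤ dT := div_nonneg (by linarith) hNr.le
  have hdTlo : κ₁ * ρ ^ 2 ≤ dT := by rw [hdT, le_div_iff₀ hNr]; linarith
  have hdThi : dT ≤ κs * ρ ^ 2 := by rw [hdT, div_le_iff₀ hNr]; linarith
  -- the times stay in `I`
  have hTI : ∀ i : ℕ, i ≤ N → T i ∈ I := by
    intro i hi
    have hi' : (i : ℝ) ≤ N := Nat.cast_le.2 hi
    refine hI.out hT₀ hT₁ ⟨?_, ?_⟩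
    · show T₀ ≤ T₀ + i * dT
      nlinarith
    · show T₀ + i * dT ≤ T₁
      have h1 : (i : ℝ) * dT ≤ N * dT := mul_le_mul_of_nonneg_right hi' hdT0
      have h2 : (N : ℝ) * dT = T₁ - T₀ := by rw [hdT]; field_simp
      linarith
  -- consecutive points are `ρ/4`-close
  have hstepdist : ∀ i : ℕ, dist (z (i + 1)) (z i) ≤ ρ / 4 := by
    intro i
    have e : z (i + 1) - z i = ((N : ℝ)⁻¹) • (x - z₀) := by
      simp only [hz_def, Nat.cast_add, Nat.cast_one]
      rw [show z₀ + (((i : ℝ) + 1) / N) • (x - z₀) - (z₀ + ((i : ℝ) / N) • (x - z₀)) =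
        (((i : ℝ) + 1) / N - (i : ℝ) / N) • (x - z₀) by rw [sub_smul]; abel]
      congr 1
      field_simp
      ring
    rw [dist_eq_norm, e, norm_smul, norm_inv, Real.norm_of_nonneg hNr.le, ← dist_eq_norm,
      inv_mul_le_iff₀ hNr]
    exact hdist
  -- induction along the chain
  have claim : ∀ i : ℕ, i ≤ N → ∀ y ∈ closedBall (z i) (ρ / 8), Λ ^ i * μ₀ ≤ u (T i) y := by
    intro i
    induction i with
    | zero =>
      intro _ y hy
      have hy' : y ∈ closedBall z₀ (ρ / 8) := by simpa [hz_def] using hy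
      simpa [hT_def] using h0 y hy'
    | succ i ih =>
      intro hi y hy
      have hi' : i ≤ N := Nat.le_of_succ_le hi
      have hl0 : (0 : ℝ) ≤ (i : ℝ) / N := by positivity
      have hl1 : (i : ℝ) / N ≤ 1 := (div_le_one hNr).2 (Nat.cast_le.2 hi')
      have hzV : closedBall (z i) ρ ⊆ V := closedBall_combo_subset hV hz₀ hx hl0 hl1
      have hgap : T (i + 1) - T i = dT := by
        simp only [hT_def, Nat.cast_add, Nat.cast_one]
        ring
      have hy3 : y ∈ closedBall (z i) (3 / 8 * ρ) := by
        rw [mem_closedBall]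
        calc dist y (z i) ≤ dist y (z (i + 1)) + dist (z (i + 1)) (z i) := dist_triangle _ _ _
          _ ≤ ρ / 8 + ρ / 4 := add_le_add (mem_closedBall.1 hy) (hstepdist i)
          _ = 3 / 8 * ρ := by ring
      have key := step (z i) (T i) (T (i + 1)) hzV (hTI i hi') (hTI (i + 1) hi)
        (by rw [hgap]; exact hdTlo) (by rw [hgap]; exact hdThi) (Λ ^ i * μ₀) (by positivity)
        (ih hi') y hy3
      calc Λ ^ (i + 1) * μ₀ = Λ * (Λ ^ i * μ₀) := by ring
        _ ≤ u (T (i + 1)) y := key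
  have hzN : z N = x := by
    simp only [hz_def]
    rw [div_self hNr.ne', one_smul]
    abel
  have hTN : T N = T₁ := by
    simp only [hT_def, hdT]
    field_simp
    ring
  have := claim N le_rfl x (by rw [hzN]; exact mem_closedBall_self (by positivity))
  rwa [hTN] at this

end Chain

end Literature.Analysis.FluidPDE

end
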